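import Summits.AnomalousDissipation.AnomalousDissipation.Theorems.TwoAndHalfDTwohalfdThesisLine
import Summits.AnomalousDissipation.AnomalousDissipation.Theorems.TwoAndHalfDTwohalfdThesisStubWeakDuhamel
import Summits.AnomalousDissipation.AnomalousDissipation.Theorems.TwoAndHalfDTwohalfdThesisStubDuhamelVariance
import Summits.AnomalousDissipation.AnomalousDissipation.Theorems.TwoAndHalfDTwohalfdThesisStubDissipationFloorLimsup
import Summits.AnomalousDissipation.AnomalousDissipation.Theorems.TwoAndHalfDTwohalfdThesisStubLiftBudget
import Summits.AnomalousDissipation.AnomalousDissipation.Theorems.TwoAndHalfDTwohalfdThesisStubGKLimsupNecessary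

/-!
# R3 `stub_limsupKernelTransfer`: the weaker kernel W' (Green–Kubo clause in `limsup` form) gives the crux by name

Stub R3 of the line `Sketch` (duhamel-release) for the crux
`Summit.AnomalousDissipation.AnomalousDissipation.Theses.TwoAndHalfD.TwohalfdThesis` (stmt-AnomalousDissipation-0206);
the statement is registered verbatim in the line's checked skeleton `Cruxes/TwohalfdThesis/Lines/Sketch.lean` §R.

CONTENT.  The line's open kernel W `stub_releasedMixingWitness` asks, besides the classical steadily forced planar
Navier–Stokes family with pointwise energy ceiling and the `j`-uniform integrable `L²` envelope for the released patterns
`φ_{j,s}` of `h`, for a Green–Kubo floor in LIMINF form, `ε ≤ liminf_T T⁻¹∫₀ᵀ (∫₀ᵗ ⟪h, φ_{j,s}(t)⟫ ds) dt`.  The crux only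
needs the `limsup`: `stub_limsupKernelTransfer` proves `W' → TwohalfdThesis`, W' being W with `liminf` replaced by `limsup`
in that last clause.  The composition is the Line file's `TwohalfdThesis_of` with D2 replaced by its `limsup` twin R2
(`stub_dissipationFloorLimsup`, landed): cold starts `θ_j` of `h` (zero datum) from
`ColdStartVariance.exists_global_coldStart`; the weak Duhamel identity D0 turns the Green–Kubo clause into a `limsup`-mean
input-power floor `ε ≤ limsup_T T⁻¹∫₀ᵀ ⟪h, θ_j⟫` (`χ = h`); D1 bounds the variance by `(s₀+M)²‖h‖²`; R2 gives the dissipation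
floor; T1/T2 lift and budget.  Since H2 `stub_gkLimsupNecessary` (landed) shows that, conversely, a dissipation floor of the
cold start forces the `limsup` Green–Kubo floor, the last clause of W' is EQUIVALENT — over any family whose cold starts
have bounded variance, in particular over any enveloped family — to "the cold start of `h` dissipates `≥ ε`":
`gkLimsup_iff_dissipationFloor` below records this for one drift.  So the kernel of the line reads: uniform integrable
envelope (whose only use is the variance bound D1) ∧ dissipation floor of the `h`-cold start.
Supports stmt-AnomalousDissipation-0206. [folklore]
-/

noncomputable section

-- the summit path `AnomalousDissipation/AnomalousDissipation` duplicates a namespace component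
set_option linter.dupNamespace false

namespace Summit.AnomalousDissipation.AnomalousDissipation.Theorems.TwohalfdThesis

open MeasureTheory Set Filter Topology
open scoped ENNReal NNReal InnerProductSpace
open Literature.Analysis.FunctionSpaces Literature.Analysis.FluidPDE
open Summit.AnomalousDissipation.AnomalousDissipation.Theses.TwoAndHalfD

/-! ## The Green–Kubo integral of the releases is the input power of the cold start -/

/-- **Duhamel for the input power, under `timeMean`.**  For the classical cold start `θ` of `h` (zero datum, `κ > 0`) and
the classical releases `φ s` of `h` from every `s ≥ 0` over the same drift, the running means of the Green–Kubo integral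
`t ↦ ∫₀ᵗ ⟪h, φ s (t)⟫ ds` and of the input power `t ↦ ⟪h, θ(t)⟫` agree for `T ≥ 0` (D0 `stub_weakDuhamel` with `χ = h`;
`timeMean` integrates over `[0, T]`). [folklore] -/
theorem limsupKernel_timeMean_gk_eq {κ : ℝ} {u : ℝ → (UnitAddTorus (Fin 2)) → (EuclideanSpace ℝ (Fin 2))}
    {h : (UnitAddTorus (Fin 2)) → ℝ} {θ : ℝ → (UnitAddTorus (Fin 2)) → ℝ} {φ : ℝ → ℝ → (UnitAddTorus (Fin 2)) → ℝ}
    (hκ : 0 < κ) (hh : Torus.IsSmooth h)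
    (hθ : Torus.IsClassicalScalarTransportForcedOn (Ici 0) κ u (fun _ => h) θ) (hθ0 : θ 0 = fun _ => (0 : ℝ))
    (hφ : ∀ s, 0 ≤ s → Torus.IsClassicalScalarTransportOn (Ici s) κ u (φ s) ∧ φ s s = h) {T : ℝ} (hT : 0 ≤ T) :
    timeMean (fun t => ∫ s in (0 : ℝ)..t, ∫ x, h x * φ s t x) T = timeMean (fun t => ∫ x, h x * θ t x) T := by
  have hId := stub_weakDuhamel κ u h θ φ hκ hh hθ hθ0 hφ h hh
  unfold timeMean
  congr 1
  refine intervalIntegral.integral_congr fun t ht => ?_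
  rw [uIcc_of_le hT] at ht
  have e := hId t ht.1
  simp_rw [mul_comm (h _)]
  exact e.symm

/-- **The `limsup` Green–Kubo clause is equivalent to the dissipation floor of the cold start** (one drift).  For the
classical cold start `θ` of `h` (zero datum, `κ > 0`) with bounded variance `‖θ(t)‖² ≤ B` (`t ≥ 0`) and the classical
releases `φ s` of `h` (`s ≥ 0`) over the same drift:
`ε ≤ limsup_T T⁻¹∫₀ᵀ (∫₀ᵗ ⟪h, φ s (t)⟫ ds) dt ↔ ε ≤ ⟨κ‖∇θ‖²⟩` (honest `limsup` mean, spectral gradient norm).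
`→` is R2 after Duhamel (`limsupKernel_timeMean_gk_eq`), `←` is H2 `stub_gkLimsupNecessary`. [folklore] -/
theorem gkLimsup_iff_dissipationFloor {κ B ε : ℝ} {u : ℝ → (UnitAddTorus (Fin 2)) → (EuclideanSpace ℝ (Fin 2))}
    {h : (UnitAddTorus (Fin 2)) → ℝ} {θ : ℝ → (UnitAddTorus (Fin 2)) → ℝ} {φ : ℝ → ℝ → (UnitAddTorus (Fin 2)) → ℝ}
    (hκ : 0 < κ) (hh : Torus.IsSmooth h)
    (hθ : Torus.IsClassicalScalarTransportForcedOn (Ici 0) κ u (fun _ => h) θ) (hθ0 : θ 0 = fun _ => (0 : ℝ))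
    (hφ : ∀ s, 0 ≤ s → Torus.IsClassicalScalarTransportOn (Ici s) κ u (φ s) ∧ φ s s = h)
    (hB : ∀ t, 0 ≤ t → Torus.scalarL2Sq (θ t) ≤ B) :
    ε ≤ limsup (timeMean fun t => ∫ s in (0 : ℝ)..t, ∫ x, h x * φ s t x) atTop ↔
      ε ≤ longTimeAvgSup (fun t => κ * (Torus.eScalarGradNormSq (θ t)).toReal) := by
  have heq : (timeMean fun t => ∫ s in (0 : ℝ)..t, ∫ x, h x * φ s t x) =ᶠ[atTop]
      (timeMean fun t => ∫ x, h x * θ t x) := by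
    filter_upwards [eventually_ge_atTop (0 : ℝ)] with T hT
    exact limsupKernel_timeMean_gk_eq hκ hh hθ hθ0 hφ hT
  constructor
  · intro hGK
    rw [Filter.limsup_congr heq] at hGK
    exact stub_dissipationFloorLimsup κ B ε u h θ hκ.le hh hθ hB hGK
  · intro hD
    exact stub_gkLimsupNecessary κ B ε u h θ φ hκ hh hθ hθ0 hφ hB hD

/-! ## The stub: W' ⇒ X -/

/-- **R3 `stub_limsupKernelTransfer` (line `Sketch` = duhamel-release, crux `TwoAndHalfD.TwohalfdThesis`).**  The body of
the line's kernel W `stub_releasedMixingWitness` with the Green–Kubo clause in `limsup` form — a smooth divergence-free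
mean-zero steady planar force `g`, a smooth mean-zero pattern `h`, viscosities `ν_j → 0`, classical solutions `(v_j, p_j)`
of the planar Navier–Stokes system forced by `g` on `[0,∞) × T²` with pointwise energy `≤ E`, the classical released
families `φ_j s` of `h` from every `s ≥ 0`, one envelope `Λ ≥ 0` with `∫₀^∞ Λ ≤ M` valid from the spin-up time `s₀` on,
uniformly in `j`, and `ε ≤ limsup_T T⁻¹∫₀ᵀ (∫₀ᵗ ⟪h, φ_j s (t)⟫ ds) dt` for every `j` — implies `TwohalfdThesis` BY NAME.
PROOF: the Line file's composition with R2 in place of D2 — cold starts `θ_j` (`exists_global_coldStart`), D0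
`stub_weakDuhamel` (the Green–Kubo means are the input-power means, `limsupKernel_timeMean_gk_eq`), D1 `stub_duhamelVariance`
(`‖θ_j(t)‖² ≤ (s₀+M)²‖h‖²`), R2 `stub_dissipationFloorLimsup` (`⟨ν_j‖∇θ_j‖²⟩ ≥ ε`), T1 `lift_isClassicalNSSolutionOn`
(`u_j = (v_j, θ_j)∘π` classical, forced by `f = (g,h)∘π`, hence global Leray–Hopf from its own slice), T2 `stub_liftBudget`
(`meanEnergy ≤ E + (s₀+M)²‖h‖²`, `meanDissipation ≥ ε`); `f` and every `u_j t` are `x₃`-invariant (`twoHalf_add_single`),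
`f` smooth, solenoidal, mean zero. [folklore] -/
theorem stub_limsupKernelTransfer :
    (∃ (g : (UnitAddTorus (Fin 2)) → (EuclideanSpace ℝ (Fin 2))) (h : (UnitAddTorus (Fin 2)) → ℝ),
      Torus.IsSmooth g ∧ Torus.IsDivFree g ∧ Torus.HasZeroMean g ∧ Torus.IsSmooth h ∧ Torus.HasZeroMean h ∧
      ∃ (ν : ℕ → ℝ) (v : ℕ → ℝ → (UnitAddTorus (Fin 2)) → (EuclideanSpace ℝ (Fin 2))) (p : ℕ → ℝ → (UnitAddTorus (Fin 2)) → ℝ) (φ : ℕ → ℝ → ℝ → (UnitAddTorus (Fin 2)) → ℝ)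
        (Λ : ℝ → ℝ) (E s₀ M ε : ℝ),
        (∀ j, 0 < ν j) ∧ Tendsto ν atTop (𝓝 0) ∧
        (∀ j, Torus.IsClassicalNSSolutionOn (Ici 0) (ν j) (fun _ => g) (v j) (p j)) ∧
        (∀ j t, 0 ≤ t → ∫ x, ‖v j t x‖ ^ 2 ≤ E) ∧
        (∀ j s, 0 ≤ s → Torus.IsClassicalScalarTransportOn (Ici s) (ν j) (v j) (φ j s) ∧ φ j s s = h) ∧
        0 ≤ s₀ ∧ (∀ τ, 0 ≤ Λ τ) ∧ IntegrableOn Λ (Ici 0) ∧ (∫ τ in Ici 0, Λ τ) ≤ M ∧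
        (∀ j s t, s₀ ≤ s → s ≤ t → Torus.scalarL2Sq (φ j s t) ≤ Λ (t - s) ^ 2 * Torus.scalarL2Sq h) ∧
        0 < ε ∧
        (∀ j, ε ≤ limsup (timeMean fun t => ∫ s in (0 : ℝ)..t, ∫ x, h x * φ j s t x) atTop)) →
    TwohalfdThesis := by
  rintro ⟨g, h, hgs, hgd, hgm, hhs, hhm, ν, v, p, φ, Λ, E, s₀, M, ε, hν, hν0, hNS, hE, hφ, hs₀, hΛ0, hΛi, hΛM,
    hEnv, hε, hGK⟩
  -- the classical cold starts `θ_j`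
  have hex : ∀ j, ∃ θ : ℝ → (UnitAddTorus (Fin 2)) → ℝ,
      Torus.IsClassicalScalarTransportForcedOn (Ici 0) (ν j) (v j) (fun _ => h) θ ∧ θ 0 = fun _ => 0 := fun j =>
    Summit.AnomalousDissipation.AnomalousDissipation.Theorems.ScalarAnomalySteadySourceFormal.ColdStartVariance.exists_global_coldStart
      (hν j) (hNS j).smooth_velocity (hNS j).divFree hhs
  choose θ hθ hθ0 using hex
  -- D0: weak Duhamel
  have hId : ∀ j (χ : (UnitAddTorus (Fin 2)) → ℝ), Torus.IsSmooth χ → ∀ t, 0 ≤ t →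
      ∫ x, θ j t x * χ x = ∫ s in (0 : ℝ)..t, ∫ x, φ j s t x * χ x := fun j =>
    stub_weakDuhamel (ν j) (v j) h (θ j) (φ j) (hν j) hhs (hθ j) (hθ0 j) (hφ j)
  -- D1: the variance bound
  have hVar : ∀ j t, 0 ≤ t → Torus.scalarL2Sq (θ j t) ≤ (s₀ + M) ^ 2 * Torus.scalarL2Sq h := fun j =>
    stub_duhamelVariance (ν j) s₀ M (v j) h (θ j) (φ j) Λ (hν j).le hhs (hθ j) (hφ j) (hId j) hs₀ hΛ0 hΛi hΛM
      (hEnv j)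
  -- the `limsup` Green–Kubo floor is a `limsup` input-power floor, so R2 gives the dissipation floor
  have hDiss : ∀ j, ε ≤ longTimeAvgSup (fun t => ν j * (Torus.eScalarGradNormSq (θ j t)).toReal) := fun j =>
    (gkLimsup_iff_dissipationFloor (hν j) hhs (hθ j) (hθ0 j) (hφ j) (hVar j)).1 (hGK j)
  -- T1: the classical lift, hence global Leray–Hopf from its own initial slice
  have hcl : ∀ j, Torus.IsClassicalNSSolutionOn (Ici 0) (ν j) (fun _ => Torus.twoHalf g h)
      (fun t => Torus.twoHalf (v j t) (θ j t)) (fun t => p j t ∘ Torus.planarProj) := fun j =>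
    lift_isClassicalNSSolutionOn _ _ _ _ _ _ (hNS j) (hθ j)
  -- T2: budgets
  have hB := fun j => stub_liftBudget (ν j) E ((s₀ + M) ^ 2 * Torus.scalarL2Sq h) g h (v j) (p j) (θ j) (hν j)
    hgs hhs (hNS j) (hθ j) (hE j) (hVar j)
  refine ⟨Torus.twoHalf g h, ?_, hgs.twoHalf hhs, hgd.twoHalf h,
    Torus.hasZeroMean_twoHalf hgs.integrable hhs.integrable hgm hhm, ν,
    fun j => Torus.twoHalf (v j 0) (θ j 0), fun j t => Torus.twoHalf (v j t) (θ j t), hν, hν0, ?_, ?_,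
    ⟨E + (s₀ + M) ^ 2 * Torus.scalarL2Sq h, fun j => (hB j).1⟩, ε, hε, fun j => (hDiss j).trans (hB j).2⟩
  · intro s x
    rw [← Torus.last_two_eq]
    exact Torus.twoHalf_add_single g h s x
  · intro j T hT
    exact (hcl j).isLerayHopfOn_of_convex (convex_Ici 0) hT Icc_subset_Ici_self
  · intro j t s x
    rw [← Torus.last_two_eq]
    exact Torus.twoHalf_add_single _ _ s x

/-! ## The kernels are ordered: W ⇒ W' (appended by lead c10) -/

/-- **The Green–Kubo means of an enveloped released family are bounded** (one drift).  With the classical cold start `θ`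
of `h` (zero datum, `κ > 0`), the classical releases `φ s` of `h` from every `s ≥ 0`, an envelope after the spin-up time
`s₀ ≥ 0` with mass `∫₀^∞ Λ ≤ M` (so that D1 `stub_duhamelVariance` bounds the variance by `(s₀+M)²‖h‖²`), the running
means of the Green–Kubo integral `t ↦ ∫₀ᵗ ⟪h, φ s (t)⟫ ds` are bounded in absolute value by `‖h‖₂ · (s₀+M)‖h‖₂` for
`T > 0`: by Duhamel (D0) they are the input-power means, and `|⟪h, θ(t)⟫| ≤ ‖h‖₂‖θ(t)‖₂` (Cauchy–Schwarz). [folklore] -/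
theorem limsupKernel_abs_timeMean_gk_le {κ s₀ M : ℝ} {u : ℝ → (UnitAddTorus (Fin 2)) → (EuclideanSpace ℝ (Fin 2))}
    {h : (UnitAddTorus (Fin 2)) → ℝ} {θ : ℝ → (UnitAddTorus (Fin 2)) → ℝ} {φ : ℝ → ℝ → (UnitAddTorus (Fin 2)) → ℝ}
    {Λ : ℝ → ℝ} (hκ : 0 < κ) (hh : Torus.IsSmooth h)
    (hθ : Torus.IsClassicalScalarTransportForcedOn (Ici 0) κ u (fun _ => h) θ) (hθ0 : θ 0 = fun _ => (0 : ℝ))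
    (hφ : ∀ s, 0 ≤ s → Torus.IsClassicalScalarTransportOn (Ici s) κ u (φ s) ∧ φ s s = h)
    (hs₀ : 0 ≤ s₀) (hΛ0 : ∀ τ, 0 ≤ Λ τ) (hΛi : IntegrableOn Λ (Ici 0)) (hΛM : (∫ τ in Ici 0, Λ τ) ≤ M)
    (hEnv : ∀ s t, s₀ ≤ s → s ≤ t → Torus.scalarL2Sq (φ s t) ≤ Λ (t - s) ^ 2 * Torus.scalarL2Sq h)
    {T : ℝ} (hT : 0 < T) :
    |timeMean (fun t => ∫ s in (0 : ℝ)..t, ∫ x, h x * φ s t x) T| ≤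
      √(Torus.scalarL2Sq h) * √((s₀ + M) ^ 2 * Torus.scalarL2Sq h) := by
  have hId := stub_weakDuhamel κ u h θ φ hκ hh hθ hθ0 hφ
  have hVar : ∀ t, 0 ≤ t → Torus.scalarL2Sq (θ t) ≤ (s₀ + M) ^ 2 * Torus.scalarL2Sq h :=
    stub_duhamelVariance κ s₀ M u h θ φ Λ hκ.le hh hθ hφ hId hs₀ hΛ0 hΛi hΛM hEnv
  rw [limsupKernel_timeMean_gk_eq hκ hh hθ hθ0 hφ hT.le]
  refine abs_timeMean_le hT fun t ht _ => ?_
  have hθt : Torus.IsSmooth (θ t) := hθ.smooth_scalar.isSmooth_slice (mem_Ici.2 ht.le)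
  have h1 := ScalarAnomalySteadySourceFormal.ColdStartVariance.integral_mul_le_sqrt_mul_sqrt (hh.memLp 2) (hθt.memLp 2)
  have h2 := ScalarAnomalySteadySourceFormal.ColdStartVariance.integral_mul_le_sqrt_mul_sqrt (hh.memLp 2).neg (hθt.memLp 2)
  simp only [Pi.neg_apply, neg_mul, integral_neg, neg_sq] at h2
  have h3 : √(∫ x, h x ^ 2) * √(∫ x, θ t x ^ 2) ≤ √(Torus.scalarL2Sq h) * √((s₀ + M) ^ 2 * Torus.scalarL2Sq h) :=
    mul_le_mul_of_nonneg_left (Real.sqrt_le_sqrt (hVar t ht.le)) (Real.sqrt_nonneg _)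
  rw [abs_le]
  exact ⟨by linarith, by linarith⟩

/-- **The kernels are ordered: W ⇒ W'.**  The body of the line's registered kernel W `stub_releasedMixingWitness`
(Green–Kubo floor in `liminf` form) implies the body of the weaker kernel W' of `stub_limsupKernelTransfer` (`limsup`
form), with the same witnesses: the Green–Kubo means of an enveloped family are bounded (`limsupKernel_abs_timeMean_gk_le`,
through the cold start of `h`, which exists by `ColdStartVariance.exists_global_coldStart`), so `liminf ≤ limsup`
honestly (`Filter.liminf_le_limsup`).  Hence S1' ⇒ W ⇒ W' ⇒ X and every refutation of W' refutes W. [folklore] -/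
theorem releasedMixingWitness_imp_limsupKernel :
    (∃ (g : (UnitAddTorus (Fin 2)) → (EuclideanSpace ℝ (Fin 2))) (h : (UnitAddTorus (Fin 2)) → ℝ),
      Torus.IsSmooth g ∧ Torus.IsDivFree g ∧ Torus.HasZeroMean g ∧ Torus.IsSmooth h ∧ Torus.HasZeroMean h ∧
      ∃ (ν : ℕ → ℝ) (v : ℕ → ℝ → (UnitAddTorus (Fin 2)) → (EuclideanSpace ℝ (Fin 2))) (p : ℕ → ℝ → (UnitAddTorus (Fin 2)) → ℝ) (φ : ℕ → ℝ → ℝ → (UnitAddTorus (Fin 2)) → ℝ)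
        (Λ : ℝ → ℝ) (E s₀ M ε : ℝ),
        (∀ j, 0 < ν j) ∧ Tendsto ν atTop (𝓝 0) ∧
        (∀ j, Torus.IsClassicalNSSolutionOn (Ici 0) (ν j) (fun _ => g) (v j) (p j)) ∧
        (∀ j t, 0 ≤ t → ∫ x, ‖v j t x‖ ^ 2 ≤ E) ∧
        (∀ j s, 0 ≤ s → Torus.IsClassicalScalarTransportOn (Ici s) (ν j) (v j) (φ j s) ∧ φ j s s = h) ∧
        0 ≤ s₀ ∧ (∀ τ, 0 ≤ Λ τ) ∧ IntegrableOn Λ (Ici 0) ∧ (∫ τ in Ici 0, Λ τ) ≤ M ∧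
        (∀ j s t, s₀ ≤ s → s ≤ t → Torus.scalarL2Sq (φ j s t) ≤ Λ (t - s) ^ 2 * Torus.scalarL2Sq h) ∧
        0 < ε ∧
        (∀ j, ε ≤ liminf (timeMean fun t => ∫ s in (0 : ℝ)..t, ∫ x, h x * φ j s t x) atTop)) →
    ∃ (g : (UnitAddTorus (Fin 2)) → (EuclideanSpace ℝ (Fin 2))) (h : (UnitAddTorus (Fin 2)) → ℝ),
      Torus.IsSmooth g ∧ Torus.IsDivFree g ∧ Torus.HasZeroMean g ∧ Torus.IsSmooth h ∧ Torus.HasZeroMean h ∧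
      ∃ (ν : ℕ → ℝ) (v : ℕ → ℝ → (UnitAddTorus (Fin 2)) → (EuclideanSpace ℝ (Fin 2))) (p : ℕ → ℝ → (UnitAddTorus (Fin 2)) → ℝ) (φ : ℕ → ℝ → ℝ → (UnitAddTorus (Fin 2)) → ℝ)
        (Λ : ℝ → ℝ) (E s₀ M ε : ℝ),
        (∀ j, 0 < ν j) ∧ Tendsto ν atTop (𝓝 0) ∧
        (∀ j, Torus.IsClassicalNSSolutionOn (Ici 0) (ν j) (fun _ => g) (v j) (p j)) ∧
        (∀ j t, 0 ≤ t → ∫ x, ‖v j t x‖ ^ 2 ≤ E) ∧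
        (∀ j s, 0 ≤ s → Torus.IsClassicalScalarTransportOn (Ici s) (ν j) (v j) (φ j s) ∧ φ j s s = h) ∧
        0 ≤ s₀ ∧ (∀ τ, 0 ≤ Λ τ) ∧ IntegrableOn Λ (Ici 0) ∧ (∫ τ in Ici 0, Λ τ) ≤ M ∧
        (∀ j s t, s₀ ≤ s → s ≤ t → Torus.scalarL2Sq (φ j s t) ≤ Λ (t - s) ^ 2 * Torus.scalarL2Sq h) ∧
        0 < ε ∧
        (∀ j, ε ≤ limsup (timeMean fun t => ∫ s in (0 : ℝ)..t, ∫ x, h x * φ j s t x) atTop) := by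
  rintro ⟨g, h, hgs, hgd, hgm, hhs, hhm, ν, v, p, φ, Λ, E, s₀, M, ε, hν, hν0, hNS, hE, hφ, hs₀, hΛ0, hΛi, hΛM,
    hEnv, hε, hGK⟩
  refine ⟨g, h, hgs, hgd, hgm, hhs, hhm, ν, v, p, φ, Λ, E, s₀, M, ε, hν, hν0, hNS, hE, hφ, hs₀, hΛ0, hΛi, hΛM,
    hEnv, hε, fun j => ?_⟩
  -- the cold start of `h` over the `j`-th flow makes the Green–Kubo means bounded
  obtain ⟨θ, hθ, hθ0⟩ :=
    Summit.AnomalousDissipation.AnomalousDissipation.Theorems.ScalarAnomalySteadySourceFormal.ColdStartVariance.exists_global_coldStart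
      (hν j) (hNS j).smooth_velocity (hNS j).divFree hhs
  have hbd : ∀ T, 0 < T → |timeMean (fun t => ∫ s in (0 : ℝ)..t, ∫ x, h x * φ j s t x) T| ≤
      √(Torus.scalarL2Sq h) * √((s₀ + M) ^ 2 * Torus.scalarL2Sq h) := fun T hT =>
    limsupKernel_abs_timeMean_gk_le (hν j) hhs hθ hθ0 (hφ j) hs₀ hΛ0 hΛi hΛM (hEnv j) hT
  have hup : IsBoundedUnder (· ≤ ·) atTop (timeMean fun t => ∫ s in (0 : ℝ)..t, ∫ x, h x * φ j s t x) :=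
    ⟨_, (eventually_gt_atTop 0).mono fun T hT => (abs_le.1 (hbd T hT)).2⟩
  have hlow : IsBoundedUnder (· ≥ ·) atTop (timeMean fun t => ∫ s in (0 : ℝ)..t, ∫ x, h x * φ j s t x) :=
    ⟨_, (eventually_gt_atTop 0).mono fun T hT => (abs_le.1 (hbd T hT)).1⟩
  exact (hGK j).trans (liminf_le_limsup hup hlow)

end Summit.AnomalousDissipation.AnomalousDissipation.Theorems.TwohalfdThesis

end
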